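import Summits.BirchSwinnertonDyer.BirchSwinnertonDyer.Theorems.PrintCf2SplitBadTwoLineDoubleCosetKerD
import Summits.BirchSwinnertonDyer.BirchSwinnertonDyer.Theorems.PrintCf2SplitBadTwoLocalDefectTrivialEval
import Summits.BirchSwinnertonDyer.BirchSwinnertonDyer.Theorems.PrintCf2SplitBadTwoStrictDefectReceptacle
import HarnessLib

/-!
# Crux `PrintCf2.SplitBadTwoRankOneOfFacts` (stmt-BirchSwinnertonDyer-20368), skeleton v13.1, stub S3d `stub_strictDefectAtVbar_two`
# (= route-C item 24036 `StrictDefectAtVbarTwo`) — class (iii): THE EQUIVARIANT INJECTION `j : Q ↪ M` ASSEMBLED (`j := eval_{φ₀} ∘ (DC-6)`), GENERIC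

Cell `bsd-print-cf2`, EXTRA WIDTH seat `bsd-line-cf2-p1-w3` g12 (prover-bsd-line-cf2-p1-w3-g12-0); `--supports stmt-BirchSwinnertonDyer-20368`
(helper, Theses-free). HONEST FRAMING: nothing here closes the crux or the registered stub S3d; BSD is not proved by any of this; no summit
statement is proved by this seat. No definition, no named fact, no `sorry`. Composition of -w8 g4's (DC-6)
`LineDoubleCoset.exists_equivariant_injective_toLocalDefectKerD` (p694414: `Q = S_nr ⧸ 𝔖 ↪ 𝓛 ⊆ H¹(D″, M)`, `Γ`-equivariant for a totally ramified line),
-w6 g5's D1 `LocalDefectTrivial.eq_zero_of_evalH1_eq_zero` / `evalH1_conjH1_eq_smul` (p695417: evaluation at a degree-one `φ₀ ∈ D″` is injective on `𝓛`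
and `D_𝔮`-equivariant when `D″` acts trivially). The frame instances (S3d's body on class (iii), `e_δ = 2 / 1`) are the sequel `…StrictDefectClassThreeOfFrame`.

* §1 (GENERIC: number field `K` totally complex, prime `p`, `ℤ_p`-line `κ` with a unit value on `I_𝔮`, `awayKer = unramifiedKer` away from `p`,
  discrete `Γ_K`-module `M` on which `D″ = ker κ ∩ D_𝔮` acts trivially, a degree-one `σ₀ ∈ Γ_{K_𝔮}` restricting to `φ₀ ∈ D″`):
  **`exists_equivariant_injective_eval`** — for every `γ ∈ Γ_K` there are `δ ∈ D_𝔮 ∩ I_𝔮` with `κ δ = κ γ` and an INJECTIVE additive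
  `j : Q →+ M` with `j ∘ (conj_γ − 1) = ((δ •) − 1) ∘ j`. The conclusion mentions neither `Coinv.kerD` cohomology nor `resH1Hom` (they stay inside the
  proof), so the concrete-`W*` instance elaborates cheaply (-w8 g4's heartbeat caveat on `kerD_inputs_of_frame`).
* Sequel `…StrictDefectClassThreeOfFrame`: `strictDefectAtVbar_two_of_frame_three` / `…_even_seven` = the hypotheses `h13` / `h07` of -w6 g5's
  `strictDefectAtVbar_two_of_classes` (p696075) as theorems (this `j` + reader p696679 + D2 p695750 + -w4 g11 p695592 + -w7 g5 p695439).

presearch: Greenberg–Vatsal 2000 §2 pp. 17, 20–21 (Cor. 2.3: `S^{Σ₀}/S ≅ ∏ 𝓗_ℓ`, `𝓗_ℓ = H¹_nr/H¹_str ≅ W*` via evaluation at Frobenius); Agboola 2007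
§3 Prop. 3.2 — held; tree assembly, no new fact. beyond-print theorem: no.

References: [GreenbergVatsal2000] §2 Prop. 2.1, Cor. 2.3, Prop. 2.4 (pp. 17–22); [Agboola2007] §3 Prop. 3.2, §5; [SerreGaloisCohomology1997] I §2.3, §2.5;
[GreenbergLNM1716] §4 Lemma 4.2.
-/

noncomputable section

open scoped Classical

-- the summit namespace `Summit.BirchSwinnertonDyer.BirchSwinnertonDyer` repeats the problem name by design (D-0017)
set_option linter.dupNamespace false
set_option autoImplicit false

open NumberField IsDedekindDomain Field
open Literature.NumberTheory.EllipticCurves Literature.NumberTheory.EllipticCurves.GreenbergSelmer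
open Literature.NumberTheory.EllipticCurves.GreenbergVatsal2000 Literature.NumberTheory.EllipticCurves.KellerYin2024
open Literature.NumberTheory.EllipticCurves.Agboola2007
open Literature.NumberTheory.EllipticCurves.IwasawaAlgebra Literature.NumberTheory.EllipticCurves.IwasawaDual
open Literature.NumberTheory.GaloisRepresentations
open Summit.BirchSwinnertonDyer.Rank1Residual.X11b
open Summit.BirchSwinnertonDyer.BirchSwinnertonDyer.Theorems.PrintCf2.UnrBaseLift (kerSubgroup_inf_inertia_le_decomp)

namespace Summit.BirchSwinnertonDyer.BirchSwinnertonDyer.Theorems.PrintCf2.StrictDefect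

/-! ## §1. Generic: `j := eval_{φ₀} ∘ (DC-6)` is an equivariant injection `Q ↪ M` -/

section Generic

variable {K : Type} [Field K] [NumberField K] {p : ℕ} [Fact p.Prime] (κ : ZpExtension K p)
  (M : Type) [AddCommGroup M] [DistribMulAction (absoluteGaloisGroup K) M] [TopologicalSpace M] [DiscreteTopology M]
  (𝔮 : HeightOneSpectrum (𝓞 K))

/-- **THE EQUIVARIANT INJECTION `Q = S_nr ⧸ 𝔖 ↪ M`** (`K` totally complex, `κ` a `ℤ_p`-line with a unit value on `I_𝔮`, `awayKer = unramifiedKer`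
away from `p`, `D″ = ker κ ∩ D_𝔮` acting trivially on the discrete module `M`, `σ₀ ∈ Γ_{K_𝔮}` of degree one restricting to `φ₀ ∈ D″`): for every
`γ ∈ Γ_K` there are `δ ∈ D_𝔮`, lying in `I_𝔮`, with `κ δ = κ γ`, and an injective additive `j : Q →+ M` with
`j ((conj_γ − 1) q) = δ • j q − j q`. Construction: -w8 g4's `Q ↪ 𝓛 ⊆ H¹(D″, M)` (`[c] ↦ res_{D″} c`, (DC-6)) followed by -w6 g5's evaluation
`𝓛 → M` at `φ₀` (injective on `𝓛`, `D_𝔮`-equivariant). Greenberg–Vatsal: the local term `𝓗 = H¹_nr/H¹_str` evaluated at Frobenius.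
[cite: GreenbergVatsal2000, §2 pp. 17, 20–21 (Cor. 2.3)] [cite: Agboola2007, §3 Prop. 3.2] [cite: SerreGaloisCohomology1997, I §2.3, §2.5] -/
theorem exists_equivariant_injective_eval [IsTotallyComplex K] (h𝔮 : ((p : ℕ) : 𝓞 K) ∈ 𝔮.asIdeal)
    (haway : ∀ w : HeightOneSpectrum (𝓞 K), ((p : ℕ) : 𝓞 K) ∉ w.asIdeal →
      GreenbergSelmer.awayKer κ.kerSubgroup M w = GreenbergVatsal2000.unramifiedKer κ.kerSubgroup M w)
    {τ₁ : absoluteGaloisGroup K} (hτ₁ : τ₁ ∈ GreenbergSelmer.inertia 𝔮) (hu : IsUnit (κ τ₁).toAdd) (γ : absoluteGaloisGroup K)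
    (htriv : ∀ (n : ↥(Coinv.kerD κ 𝔮)) (m : M), n • m = m)
    {σ₀ : absoluteGaloisGroup (𝔮.adicCompletion K)} (hσ₀ : IsFrobPow σ₀ 1)
    {φ₀ : ↥(Coinv.kerD κ 𝔮)} (hφ₀ : ((φ₀ : ↥(decomp 𝔮)) : absoluteGaloisGroup K) = absGaloisRestrict K (𝔮.adicCompletion K) σ₀) :
    ∃ (δ : absoluteGaloisGroup K) (_ : δ ∈ decomp 𝔮) (_ : δ ∈ GreenbergSelmer.inertia 𝔮) (_ : κ δ = κ γ)
      (j : (↥(unrSelmer κ M 𝔮 ∅) ⧸ (restrictedSelmerZp κ M 𝔮).addSubgroupOf (unrSelmer κ M 𝔮 ∅)) →+ M),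
      Function.Injective j ∧
      ∀ q, j (QuotientAddGroup.map _ _
          ((conjUnr κ M 𝔮 ∅ γ - 1 : AddMonoid.End (unrSelmer κ M 𝔮 ∅)) : unrSelmer κ M 𝔮 ∅ →+ unrSelmer κ M 𝔮 ∅)
          (addSubgroupOf_le_comap_conjUnr_sub_one κ M 𝔮 γ) q) =
        (DistribMulAction.toAddMonoidEnd (absoluteGaloisGroup K) M δ - 1) (j q) := by
  obtain ⟨τ, hτI, hκτ, j₀, hj₀, -, hje₀⟩ :=
    LineDoubleCoset.exists_equivariant_injective_toLocalDefectKerD κ M 𝔮 h𝔮 haway hτ₁ hu γ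
  -- `e := eval_{φ₀}` restricted to `𝓛`
  let e : ↥(resH1Hom (Coinv.toKerD κ 𝔮 (kerSubgroup_inf_inertia_le_decomp κ 𝔮) (inf_le_left : κ.kerSubgroup ⊓ inertia 𝔮 ≤ κ.kerSubgroup))
      (AddMonoidHom.id M) (fun _ _ ↦ rfl)).ker →+ M :=
    (evalH1 htriv φ₀).comp (AddSubgroup.subtype _)
  have he : ∀ a, e a = evalH1 htriv φ₀ (a : subgroupH1 (Coinv.kerD κ 𝔮) M) := fun _ ↦ rfl
  refine ⟨τ, τ.2, hτI, hκτ, e.comp j₀, ?_, fun q ↦ ?_⟩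
  · -- injectivity: `eval_{φ₀}` is injective on `𝓛` (-w6 g5), `j₀` is injective (-w8 g4)
    refine (injective_iff_map_eq_zero _).mpr fun q hq ↦ ?_
    have hmem : resH1Hom (Coinv.toKerD κ 𝔮 (kerSubgroup_inf_inertia_le_decomp κ 𝔮)
        (inf_le_left : κ.kerSubgroup ⊓ inertia 𝔮 ≤ κ.kerSubgroup)) (AddMonoidHom.id M) (fun _ _ ↦ rfl)
        (j₀ q : subgroupH1 (Coinv.kerD κ 𝔮) M) = 0 := (AddMonoidHom.mem_ker).mp (j₀ q).2
    have h0 : evalH1 htriv φ₀ (j₀ q : subgroupH1 (Coinv.kerD κ 𝔮) M) = 0 := by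
      rw [← he]; exact hq
    have hz := LocalDefectTrivial.eq_zero_of_evalH1_eq_zero κ 𝔮 htriv hσ₀ hφ₀ hmem h0
    exact (injective_iff_map_eq_zero j₀).mp hj₀ q (Subtype.ext hz)
  · -- equivariance: `eval(conj_τ a − a) = τ • eval a − eval a`
    simp only [AddMonoidHom.comp_apply, AddSubgroup.subtype_apply, smulEnd_sub_one_apply, e]
    rw [hje₀ q, map_sub, LocalDefectTrivial.evalH1_conjH1_eq_smul κ 𝔮 htriv hφ₀ τ ((AddMonoidHom.mem_ker).mp (j₀ q).2)]

end Generic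

end Summit.BirchSwinnertonDyer.BirchSwinnertonDyer.Theorems.PrintCf2.StrictDefect

end
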